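import Literature.MathematicalPhysics.QuantumFieldTheory.Balaban1983to89.Node00.N24NodesStage13XReboundPointedAtFamiliesSep
import Literature.MathematicalPhysics.QuantumFieldTheory.Balaban1983to89.Node00.Record13CarriersXPinned

/-!
# BalabanUVNodes ∕ N10 — THE K1⁗ ENGINE'S CLOSERS AT THE X-PINNED CARRIERS OF RECORD `X' := XPinned₁₃ F N θ lam8 lam12 lam13`, v1.2 (rev-18) KEY: dag-n24-c's modules 43⁗
# `N24NodesStage13XReboundPointedSep` (θ- and X'-generic; + at the live witness of record) and 44⁗ `N24NodesStage13XReboundPointedAtFamiliesSep` (at node00-def-K0a's Stage-13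
# witness families) BY NAME, with the three X-reading sockets — N05 `h05`, N09 `h09`, N10 `h10` — READ AS THE THREE LEAVES OF RECORD at `(lam8, lam12, lam13)` and every other socket
# θ-keyed — the token-map twin (`Provisos₁₃ ↦ Provisos₁₃Sep`, `datumOfRecord₁₃ ↦ datumOfRecord₁₃Sep`, `IsRecordOfRecord₁₃C ↦ IsRecordOfRecord₁₃CSep`) of this seat's
# `…N10XPinnedClosers13` (p502889), plus the REGISTERED RUNG-1 BODY at the X-pinned parameter (Track A, DAG node N10 [B13] ∕ binder N24; strategy s2; seat `pub-ymgap-dag-n10-d` g8; composite, count-neutral)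

HONEST FRAMING.  Count-neutral kernel bookkeeping BY NAME over LANDED modules: dag-n24-c's 43⁗ `N24NodesStage13XReboundPointedSep` (the thirteen nodes, item K1⁗'s θ-keyed consequent —
the rev-18 text of «StabilityBAtRecordR13Sep» under node00-def-T's token map — and the rung-2 body over the four-pin Stage-13 view of `θ.rebindX X'`, X-reading sockets at `X' P`,
every other socket θ-keyed; the same at the live witness of record `theta13LiveOfRecord F N`, where guard, admissibility and N13's (R₁₃) are hypothesis-free theorems) and 44⁗
`N24NodesStage13XReboundPointedAtFamiliesSep` (the same at K0a's members `theta13LiveOfNumerics …` ∕ `theta13LiveOfFamily₂ …`), and this seat's `Node00/Record13CarriersXPinned`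
(p497764: `XPinned₁₃`, `Stage13Params.pinX3 := θ.rebindX (XPinned₁₃ …)`, `socket05∕09∕10_pinX3_iff : Iff.rfl` — θ-level, untouched by the rev-18 re-key).  WHY (dag-n10-d g6
LOCATED-N24-XSOCKET, dag-lead DEDUP-251∕252 (R3), dag-ref-D READ-174∕175): at every K0a witness the residual carrier family `res.X` is the degenerate `Classical.choice` one, so
the engine's X-reading sockets are served ONLY at an X-pinned parameter; THIS FILE TAKES `X' :=` THE CARRIERS OF RECORD and reads the three sockets as the three nodes' LEAVES:
N05 ← dag-n05-d's typed [B8″] leaf form at `lam8` (C-binding form AS TYPED in the engine), N09 ← `B12Sec2to5.Lemma4Printed (F12OfRecord₁₂ F N θ.toStage12Params lam12 P) (lam12 P).consts`,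
N10 ← `B13LeafOfRecord θ₃ (lam13 P)` (node00-def-B13's group of record; this seat's junctions `b13LeafOfRecord_of_located(_termwise ∕ _walks …)` conclude exactly it).  Every proof
is ONE application of 43⁗ ∕ 44⁗ at `X' := XPinned₁₃ F N θ lam8 lam12 lam13` with `h05 ∕ h09 := (socket0k_pinX3_iff …).2 (h0k P)`, `h10 := fun P _ _ _ _ => (socket10_pinX3_iff …).2 (h10 P)`;
`hup` is displayed over `(θ.pinX3 F N lam8 lam12 lam13).view₁₃B10YZW …` (definitionally the engine's `(θ.rebindX F N X').view₁₃B10YZW …`, `pinX3_eq_rebindX`).  §1–§3 generated from the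
engine's text by this seat's `tools/gen_closers.py` (the p502889 generator, unchanged).  COMPOSITE: every socket is a hypothesis (the three leaves included); `hP : Provisos₁₃Sep`
DISPLAYED (K0⁗ «Record13SepInhabited», stmt-QuantumFields-20289 — no `.bg` consumer here); nothing discharged; NOT `stub_nodes13P` ∕ `stub_betaWindow13P`; nothing of Bałaban's
asserted; N05 ∕ N09 ∕ N10 ∕ N24 NOT discharged; no count moves (typed 28∕28 · discharged 5∕27); one finite four-torus programme at fixed ε per run; nothing continuum ∕ ℝ⁴ ∕ OS ∕
mass-gap ∕ Clay.  0 `sorry`, 0 `def`, 0 `instance`, 0 `notation`, standard axioms.  Filed `--kind proof --supports` K1⁗ «StabilityBAtRecordR13Sep» (stmt-QuantumFields-20290) `--as helper`.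

WHAT THIS FILE PROVES.  §1 (θ-generic) `nodes₁₃Sep_pinX3_of_leaves`, ★ `stabilityBR13Sep_thetaShape18_pinX3_of_leaves`, ★ `betaWindowAtSomeRecord₁₃Sep_pinX3_of_leaves_of_boxH`;
§2 (at K0a's members) ★ `stabilityBR13Sep_thetaShape18_pinX3_of_leaves_theta13LiveOfNumerics`, `betaWindowAtSomeRecord₁₃Sep_pinX3_of_leaves_theta13LiveOfNumerics_of_boxH`,
★ `stabilityBR13Sep_thetaShape18_pinX3_of_leaves_theta13LiveOfFamily₂`, `betaWindowAtSomeRecord₁₃Sep_pinX3_of_leaves_theta13LiveOfFamily₂_of_boxH` (43⁗ §2's forms at the live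
witness of record are §1 at `θ := theta13LiveOfRecord F N` with K0a's hypothesis-free guard — not re-declared);
§3 ★★ `nodesAtSomeRecord₁₃SepP_pinX3_of_leaves` — the BODY of the registered rung `K1Skeleton13Sep.NodesAtSomeRecord13P` (v2; general `N`) witnessed by `(θ, hP, w)` = the `stub_nodes13P`
closer shape modulo the displayed sockets — and ★★ `nodesAtSomeRecord₁₃SepP_allPinned_of_leaves` — the same with the world-binding conjunct kept and the seven residual data ∃-bound
(every residual group pinned BY NAME: a candidate rung-1 v3 text, plan g67 l.17101 (4)).  New relative to p502889: §3.
-/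

noncomputable section

namespace Summit.QuantumFields.YangMills.BalabanUVNodes.N10XPinnedClosers13Sep

open Literature.MathematicalPhysics.QuantumFieldTheory.Balaban1983to89
open Literature.MathematicalPhysics.QuantumFieldTheory.Balaban1983to89.T4Continuum
open Literature.MathematicalPhysics.QuantumFieldTheory.Balaban1983to89.T4DatumAssembly
open Literature.MathematicalPhysics.QuantumFieldTheory.Balaban1983to89.DagBinding
open Literature.MathematicalPhysics.QuantumFieldTheory.Balaban1983to89.FlowStepRuns
open Literature.MathematicalPhysics.QuantumFieldTheory.Balaban1983to89.AveragingRT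
open Literature.MathematicalPhysics.QuantumFieldTheory.Balaban1983to89.FlowStep (BetaLowerH BetaUpperH)
open Literature.MathematicalPhysics.QuantumFieldTheory.Balaban1983to89.B8IdxB8LawsB (IdxB8SubB famB8OfRecordSubB)
open Literature.MathematicalPhysics.QuantumFieldTheory.Balaban1983to89.Node00
open scoped Matrix.Norms.L2Operator

variable {F : T4Family} {N : ℕ} [NeZero N]

/-! ## §1. θ-generic: the engine at `X' := XPinned₁₃ F N θ lam8 lam12 lam13`, the three X-sockets ← the three leaves of record (v1.2 key) -/
/-- **THE THIRTEEN DAG NODES AT A WORLD BOUND TO THE FOUR-PIN STAGE-13 VIEW OF THE X-PINNED PARAMETER `θ.pinX3 lam8 lam12 lam13`, v1.2 (rev-18) KEY: THE THREE X-READING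
CHILDREN ← THEIR LEAVES OF RECORD, EVERY OTHER SOCKET θ-KEYED** — dag-n24-c's module 43⁗ `N24_nodes₁₃Sep_rebindX_fourPin_pointed` at `X' := XPinned₁₃ F N θ lam8 lam12 lam13` with
`h05 ∕ h09 ∕ h10` supplied through `socket05∕09∕10_pinX3_iff` from dag-n05-d's [B8″] leaf form at `lam8`, Lemma 4 at the [B12] frame of record at `lam12`, and `B13LeafOfRecord θ₃ (lam13 P)`;
`hP : θ.Provisos₁₃Sep F N` displayed (K0⁗ «Record13SepInhabited», stmt-QuantumFields-20289), the record is `IsRecordOfRecord₁₃CSep … (datumOfRecord₁₃Sep F N θ hP) w` — θ's OWN datum.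
At the live witness of record `θ := theta13LiveOfRecord F N` (43⁗ §2) read this with K0a's hypothesis-free `admissible_∕ztUnity_∕slotsNondegenerate₁₃_theta13LiveOfRecord(_of_hasResiduals)`
and dag-n11-e's `laws₁₃_theta13LiveOfRecord` for `hR` — one `exact`, not re-declared here.  COMPOSITE; nothing discharged. [cite: Balaban1985RegularSpaces, Thm 2 p.83; Balaban1987RG1, Lemma 4 p.280, Thm 1 p.259, Thm 3 p.264, (1.22) p.264, (2.9) p.266; Balaban1988RG2Cluster, Lemmas 1–3 pp.9, 11, 20; Balaban1989LargeFieldII, Thm 1 p.355, (0.1) pp.355–356, p.391; Balaban1985UV3, Thm 1 p.257 + Thm 2 p.272; Balaban1985BackgroundPropagators, Thm 3.1 p.397; Balaban1985Variational, Thm 1 p.279; Balaban1988Convergent, Thm 1 p.262, (2.18) p.257, (2.28) p.259, Cor. 3 (2.50) p.264, (3.16)–(3.22) pp.268–269; Balaban1989LargeFieldI, Prop. 1 p.194, (0.2)–(0.4) p.176 (bookkeeping)] -/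
theorem nodes₁₃Sep_pinX3_of_leaves (θ : Stage13Params F N) (hP : θ.Provisos₁₃Sep F N) (hθ : θ.Admissible F N)
    (lam8 : ResidB8 θ.toStage3Params) (lam12 : ResidB12 F N θ.τ9.M) (lam13 : B12.RunParams → ResidB13 θ.toStage3Params) (Mstar : ℕ) (ops : OpsY N θ.toStage3Params Mstar) (ζ : ResidZ F N)
    (lamW : ResidW F N) (w : WorldP) (hC : w.C = (datumOfRecord₁₃Sep F N θ hP).C) (hγ : 0 < w.γ ∧ w.γ ≤ θ.γ) (hL : w.L = (θ.L : ℝ))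
    (hup : ∀ P, w.up P = upOfRecord₅C F N ((θ.pinX3 F N lam8 lam12 lam13).view₁₃B10YZW F N Mstar ops ζ lamW) P)
    (h05 : ∀ P : B12.RunParams, B8LeafR θ.D (θ.L : ℝ) lam8.C₂ lam8.B₁' lam8.inp.B₀' lam8.B₁ lam8.B₂ lam8.c₁ lam8.inp lam8.B₀β
      (B8Lemma1NonAbelian.blockPairNA θ.D θ.L θ.𝔸) (fun j : IdxB8SubB θ.toStage3Params => famB8OfRecordSubB θ.toStage3Params lam8.β lam8.len j)
      lam8.lan lam8.cub (fun j => lam8.toAxial j.1))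
    (h06 : B9LeafX (Y9OfRecord N θ.toStage3Params Mstar ops)) (h07 : B11Leaf (Z11OfRecord F N ζ)) (h08 : PrintedUV3V N θ.L)
    (h09 : ∀ P : B12.RunParams, B12Sec2to5.Lemma4Printed (F12OfRecord₁₂ F N θ.toStage12Params lam12 P) (lam12 P).consts)
    (h09T : ∀ P : B12.RunParams, (leavesP w P).smallCouplings → (leavesP w P).smallFieldInductive) (h10 : ∀ P : B12.RunParams, B13LeafOfRecord θ.toStage3Params (lam13 P))
    (h11 : ∀ P : B12.RunParams, (leavesP w P).b7 → (leavesP w P).b8 → (leavesP w P).b9 → (leavesP w P).b10 → (leavesP w P).b11 →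
      (leavesP w P).smallCouplings → (leavesP w P).smallFieldInductive → (leavesP w P).flowControl →
        ∀ k, k < P.K → SLaw₁₃ F N θ P k → TLaw₁₃ F N θ P k)
    (h12 : ∀ P : B12.RunParams, B15Leaf (WOfRecord₁₃ F N θ lamW P)) (hR : ∀ (P : B12.RunParams) (k : ℕ), k < P.K → TLaw₁₃ F N θ P k → SLaw₁₃ F N θ P (k + 1))
    (hUV : ∀ P : B12.RunParams, (genFlow (betaOfRecord₁₃ F N θ) P.g0).InInterval w.γ P.K → ∀ k, k ≤ P.K → SLaw₁₃ F N θ P k →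
      ∀ U : GaugeField (F.P P.K) k (SU N),
        chiβOfRecord₁₃ F N θ P.K (gOfRecord₁₃ F N θ P) k U *
              Real.exp (-(1 / (gOfRecord₁₃ F N θ P k) ^ 2 * wilsonBGOfRecord F N θ.εbg P k U)
                - w.em (gOfRecord₁₃ F N θ P k) * (Fintype.card (Site (F.P P.K) k) : ℝ)) ≤ densOfRecord₁₃ F N θ P k U ∧
        densOfRecord₁₃ F N θ P k U ≤ Real.exp (w.ep (gOfRecord₁₃ F N θ P k) * (Fintype.card (Site (F.P P.K) k) : ℝ))) :
    IsRecordOfRecord₁₃CSep F N (datumOfRecord₁₃Sep F N θ hP) w ∧ ∀ P : B12.RunParams, Nodes (leavesP w P) :=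
  N24_nodes₁₃Sep_rebindX_fourPin_pointed θ hP hθ (XPinned₁₃ F N θ lam8 lam12 lam13) Mstar ops ζ lamW w hC hγ hL hup (fun P => (socket05_pinX3_iff F N θ lam8 lam12 lam13 P).2 (h05 P)) h06 h07 h08
    (fun P => (socket09_pinX3_iff F N θ lam8 lam12 lam13 P).2 (h09 P)) h09T (fun P _ _ _ _ => (socket10_pinX3_iff F N θ lam8 lam12 lam13 P).2 (h10 P)) h11 h12 hR hUV

/-- **★ ITEM K1⁗'s θ-KEYED CONSEQUENT (the rev-18 text of «StabilityBAtRecordR13Sep» under the token map) WITNESSED BY `(θ, hP)`, CHILDREN OVER THE FOUR-PIN VIEW OF THE X-PINNED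
PARAMETER, N05 ∕ N09 ∕ N10 ← THEIR LEAVES OF RECORD** (module 43⁗ §1 `N24_stabilityBR13Sep_thetaShape18_rebindX_fourPin_pointed` at `X' := XPinned₁₃ F N θ lam8 lam12 lam13`; guard `hU`,
`Provisos₁₃Sep`, admissibility, the nine carrier-blind sockets and the β-box pair displayed θ-keyed).  COMPOSITE; NOT the stub. [cite: Balaban1989LargeFieldII, Thm 1 p.355, (0.1) pp.355–356, p.391; Balaban1988Convergent, (2.18) p.257, (2.28) p.259, (3.16)–(3.22) pp.268–269; Balaban1987RG1, Thm 3 p.264, (0.17)–(0.21) pp.255–256 and (1.22) p.264, (2.9) p.266; Balaban1985RegularSpaces, Thm 2 p.83; Balaban1987RG1, Lemma 4 p.280; Balaban1988RG2Cluster, Lemmas 1–3 pp.9–20; Balaban1985UV3, Thm 1 p.257 (bookkeeping + elementary window)] -/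
theorem stabilityBR13Sep_thetaShape18_pinX3_of_leaves (θ : Stage13Params F N) (hP : θ.Provisos₁₃Sep F N) (hθ : θ.Admissible F N) (hU : θ.ZtUnity F N ∧ θ.SlotsNondegenerate₁₃ F N)
    (lam8 : ResidB8 θ.toStage3Params) (lam12 : ResidB12 F N θ.τ9.M) (lam13 : B12.RunParams → ResidB13 θ.toStage3Params) (Mstar : ℕ) (ops : OpsY N θ.toStage3Params Mstar) (ζ : ResidZ F N)
    (lamW : ResidW F N) (w : WorldP) (hC : w.C = (datumOfRecord₁₃Sep F N θ hP).C) (hγ : 0 < w.γ ∧ w.γ ≤ θ.γ) (hL : w.L = (θ.L : ℝ))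
    (hup : ∀ P, w.up P = upOfRecord₅C F N ((θ.pinX3 F N lam8 lam12 lam13).view₁₃B10YZW F N Mstar ops ζ lamW) P)
    (h05 : ∀ P : B12.RunParams, B8LeafR θ.D (θ.L : ℝ) lam8.C₂ lam8.B₁' lam8.inp.B₀' lam8.B₁ lam8.B₂ lam8.c₁ lam8.inp lam8.B₀β
      (B8Lemma1NonAbelian.blockPairNA θ.D θ.L θ.𝔸) (fun j : IdxB8SubB θ.toStage3Params => famB8OfRecordSubB θ.toStage3Params lam8.β lam8.len j)
      lam8.lan lam8.cub (fun j => lam8.toAxial j.1))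
    (h06 : B9LeafX (Y9OfRecord N θ.toStage3Params Mstar ops)) (h07 : B11Leaf (Z11OfRecord F N ζ)) (h08 : PrintedUV3V N θ.L)
    (h09 : ∀ P : B12.RunParams, B12Sec2to5.Lemma4Printed (F12OfRecord₁₂ F N θ.toStage12Params lam12 P) (lam12 P).consts)
    (h09T : ∀ P : B12.RunParams, (leavesP w P).smallCouplings → (leavesP w P).smallFieldInductive) (h10 : ∀ P : B12.RunParams, B13LeafOfRecord θ.toStage3Params (lam13 P))
    (h11 : ∀ P : B12.RunParams, (leavesP w P).b7 → (leavesP w P).b8 → (leavesP w P).b9 → (leavesP w P).b10 → (leavesP w P).b11 →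
      (leavesP w P).smallCouplings → (leavesP w P).smallFieldInductive → (leavesP w P).flowControl →
        ∀ k, k < P.K → SLaw₁₃ F N θ P k → TLaw₁₃ F N θ P k)
    (h12 : ∀ P : B12.RunParams, B15Leaf (WOfRecord₁₃ F N θ lamW P)) (hR : ∀ (P : B12.RunParams) (k : ℕ), k < P.K → TLaw₁₃ F N θ P k → SLaw₁₃ F N θ P (k + 1))
    (hUV : ∀ P : B12.RunParams, (genFlow (betaOfRecord₁₃ F N θ) P.g0).InInterval w.γ P.K → ∀ k, k ≤ P.K → SLaw₁₃ F N θ P k →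
      ∀ U : GaugeField (F.P P.K) k (SU N),
        chiβOfRecord₁₃ F N θ P.K (gOfRecord₁₃ F N θ P) k U *
              Real.exp (-(1 / (gOfRecord₁₃ F N θ P k) ^ 2 * wilsonBGOfRecord F N θ.εbg P k U)
                - w.em (gOfRecord₁₃ F N θ P k) * (Fintype.card (Site (F.P P.K) k) : ℝ)) ≤ densOfRecord₁₃ F N θ P k U ∧
        densOfRecord₁₃ F N θ P k U ≤ Real.exp (w.ep (gOfRecord₁₃ F N θ P k) * (Fintype.card (Site (F.P P.K) k) : ℝ)))
    (hlo : BetaLowerH w.b w.γ (datumOfRecord₁₃Sep F N θ hP).βfun) (hhi : BetaUpperH w.βup w.γ (datumOfRecord₁₃Sep F N θ hP).βfun) :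
    ∃ (θ' : Stage13Params F N) (h' : θ'.Provisos₁₃Sep F N), (θ'.ZtUnity F N ∧ θ'.SlotsNondegenerate₁₃ F N) ∧ θ'.Admissible F N ∧
      B16.EndStatementBPrinted (datumOfRecord₁₃Sep F N θ' h').C ∧
      ∃ γ₁ : ℝ, 0 < γ₁ ∧ ∀ γ : ℝ, 0 < γ → γ ≤ γ₁ → ∃ P : B12.RunParams, 1 ≤ P.K ∧ ((datumOfRecord₁₃Sep F N θ' h').C P).flow.InInterval γ P.K :=
  N24_stabilityBR13Sep_thetaShape18_rebindX_fourPin_pointed θ hP hθ hU (XPinned₁₃ F N θ lam8 lam12 lam13) Mstar ops ζ lamW w hC hγ hL hup (fun P => (socket05_pinX3_iff F N θ lam8 lam12 lam13 P).2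
    (h05 P)) h06 h07 h08 (fun P => (socket09_pinX3_iff F N θ lam8 lam12 lam13 P).2 (h09 P)) h09T (fun P _ _ _ _ => (socket10_pinX3_iff F N θ lam8 lam12 lam13 P).2 (h10 P)) h11 h12 hR hUV hlo hhi

/-- **THE ∃-BODY OF THE rev-18 RUNG `BetaWindowAtSomeRecord13` WITNESSED BY `(θ, hP, w)` OVER THE FOUR-PIN VIEW OF THE X-PINNED PARAMETER, N05 ∕ N09 ∕ N10 ← THEIR LEAVES OF RECORD**
(module 43⁗ §1 `N24_betaWindowAtSomeRecord₁₃Sep_of_rebindX_fourPin_pointed_of_boxH` at `X' := XPinned₁₃ F N θ lam8 lam12 lam13`).  COMPOSITE; NOT the stub. [cite: Balaban1989LargeFieldII, Thm 1 p.355, (0.1) pp.355–356, p.391; Balaban1988Convergent, (2.18) p.257, (2.28) p.259, (3.16)–(3.22) pp.268–269; Balaban1987RG1, Thm 3 p.264, (0.17)–(0.21) pp.255–256 and (1.22) p.264, (2.9) p.266; Balaban1985RegularSpaces, Thm 2 p.83; Balaban1987RG1, Lemma 4 p.280; Balaban1988RG2Cluster, Lemmas 1–3 pp.9–20; Balaban1985UV3,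 Thm 1 p.257 (bookkeeping + elementary window)] -/
theorem betaWindowAtSomeRecord₁₃Sep_pinX3_of_leaves_of_boxH (θ : Stage13Params F N) (hP : θ.Provisos₁₃Sep F N) (hθ : θ.Admissible F N) (hU : θ.ZtUnity F N ∧ θ.SlotsNondegenerate₁₃ F N)
    (lam8 : ResidB8 θ.toStage3Params) (lam12 : ResidB12 F N θ.τ9.M) (lam13 : B12.RunParams → ResidB13 θ.toStage3Params) (Mstar : ℕ) (ops : OpsY N θ.toStage3Params Mstar) (ζ : ResidZ F N)
    (lamW : ResidW F N) (w : WorldP) (hC : w.C = (datumOfRecord₁₃Sep F N θ hP).C) (hγ : 0 < w.γ ∧ w.γ ≤ θ.γ) (hL : w.L = (θ.L : ℝ))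
    (hup : ∀ P, w.up P = upOfRecord₅C F N ((θ.pinX3 F N lam8 lam12 lam13).view₁₃B10YZW F N Mstar ops ζ lamW) P)
    (h05 : ∀ P : B12.RunParams, B8LeafR θ.D (θ.L : ℝ) lam8.C₂ lam8.B₁' lam8.inp.B₀' lam8.B₁ lam8.B₂ lam8.c₁ lam8.inp lam8.B₀β
      (B8Lemma1NonAbelian.blockPairNA θ.D θ.L θ.𝔸) (fun j : IdxB8SubB θ.toStage3Params => famB8OfRecordSubB θ.toStage3Params lam8.β lam8.len j)
      lam8.lan lam8.cub (fun j => lam8.toAxial j.1))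
    (h06 : B9LeafX (Y9OfRecord N θ.toStage3Params Mstar ops)) (h07 : B11Leaf (Z11OfRecord F N ζ)) (h08 : PrintedUV3V N θ.L)
    (h09 : ∀ P : B12.RunParams, B12Sec2to5.Lemma4Printed (F12OfRecord₁₂ F N θ.toStage12Params lam12 P) (lam12 P).consts)
    (h09T : ∀ P : B12.RunParams, (leavesP w P).smallCouplings → (leavesP w P).smallFieldInductive) (h10 : ∀ P : B12.RunParams, B13LeafOfRecord θ.toStage3Params (lam13 P))
    (h11 : ∀ P : B12.RunParams, (leavesP w P).b7 → (leavesP w P).b8 → (leavesP w P).b9 → (leavesP w P).b10 → (leavesP w P).b11 →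
      (leavesP w P).smallCouplings → (leavesP w P).smallFieldInductive → (leavesP w P).flowControl →
        ∀ k, k < P.K → SLaw₁₃ F N θ P k → TLaw₁₃ F N θ P k)
    (h12 : ∀ P : B12.RunParams, B15Leaf (WOfRecord₁₃ F N θ lamW P)) (hR : ∀ (P : B12.RunParams) (k : ℕ), k < P.K → TLaw₁₃ F N θ P k → SLaw₁₃ F N θ P (k + 1))
    (hUV : ∀ P : B12.RunParams, (genFlow (betaOfRecord₁₃ F N θ) P.g0).InInterval w.γ P.K → ∀ k, k ≤ P.K → SLaw₁₃ F N θ P k →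
      ∀ U : GaugeField (F.P P.K) k (SU N),
        chiβOfRecord₁₃ F N θ P.K (gOfRecord₁₃ F N θ P) k U *
              Real.exp (-(1 / (gOfRecord₁₃ F N θ P k) ^ 2 * wilsonBGOfRecord F N θ.εbg P k U)
                - w.em (gOfRecord₁₃ F N θ P k) * (Fintype.card (Site (F.P P.K) k) : ℝ)) ≤ densOfRecord₁₃ F N θ P k U ∧
        densOfRecord₁₃ F N θ P k U ≤ Real.exp (w.ep (gOfRecord₁₃ F N θ P k) * (Fintype.card (Site (F.P P.K) k) : ℝ)))
    (hlo : BetaLowerH w.b w.γ (datumOfRecord₁₃Sep F N θ hP).βfun) (hhi : BetaUpperH w.βup w.γ (datumOfRecord₁₃Sep F N θ hP).βfun) :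
    ∃ (θ' : Stage13Params F N) (h' : θ'.Provisos₁₃Sep F N) (w' : WorldP), (θ'.ZtUnity F N ∧ θ'.SlotsNondegenerate₁₃ F N) ∧ θ'.Admissible F N ∧
      IsRecordOfRecord₁₃CSep F N (datumOfRecord₁₃Sep F N θ' h') w' ∧ (∀ P : B12.RunParams, Nodes (leavesP w' P)) ∧
      BetaBoundsInInterval w'.C.toB12 w'.γ w'.b w'.βup ∧
      ∃ γ₁ : ℝ, 0 < γ₁ ∧ ∀ γ : ℝ, 0 < γ → γ ≤ γ₁ → ∃ P : B12.RunParams, 1 ≤ P.K ∧ ((datumOfRecord₁₃Sep F N θ' h').C P).flow.InInterval γ P.K :=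
  N24_betaWindowAtSomeRecord₁₃Sep_of_rebindX_fourPin_pointed_of_boxH θ hP hθ hU (XPinned₁₃ F N θ lam8 lam12 lam13) Mstar ops ζ lamW w hC hγ hL hup (fun P => (socket05_pinX3_iff F N θ lam8 lam12
    lam13 P).2 (h05 P)) h06 h07 h08 (fun P => (socket09_pinX3_iff F N θ lam8 lam12 lam13 P).2 (h09 P)) h09T (fun P _ _ _ _ => (socket10_pinX3_iff F N θ lam8 lam12 lam13 P).2 (h10 P)) h11 h12 hR
    hUV hlo hhi

/-! ## §2. At node00-def-K0a's Stage-13 witness families (`Admissible`, `SlotsNondegenerate₁₃`, (R₁₃) are theorems there) -/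
/-- **★ ITEM K1⁗'s θ-KEYED CONSEQUENT WITNESSED BY K0a's ALL-NUMERICS MEMBER `(theta13LiveOfNumerics F N n ε₂₉ ζ Rz Zt, hP)`, CHILDREN OVER THE FOUR-PIN VIEW OF ITS X-PINNED
PARAMETER `θL.pinX3 lam8 lam12 lam13`, N05 ∕ N09 ∕ N10 ← THEIR LEAVES OF RECORD** (module 44⁗ §1 at `X' := XPinned₁₃ F N θL lam8 lam12 lam13`; `Admissible`, `SlotsNondegenerate₁₃` (from
`hP.tstep ∕ hP.rstep`), (R₁₃) are THEOREMS there — K0a FILE 9, dag-n11-e `laws₁₃_liveRepin₁₃_sep` —, `hZ`, `hP`, `n.Pos`, `0 < ε₂₉`, the three signs of `n` displayed exactly as in module 44⁗).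
Plan SKELETON-V7's K0⁗ witness θ₁₅ᶜ = `theta13OfThm1C F 2 ε₀ ε₂₉ B₃ a₀ a₁` is the member `n := stage12NumericsOfThm1C …` (node00-def-K0a `Record13NumericsOfThm1C`).  COMPOSITE; NOT the stub. [cite: Balaban1989LargeFieldII, Thm 1 p.355, (0.1) pp.355–356, p.391; Balaban1988Convergent, p.244, Thm 2 p.263, (2.4) p.255, (2.18) p.257, (2.28) p.259, (3.16)–(3.22) pp.268–269; Balaban1989LargeFieldI, (0.2)–(0.4) p.176; Balaban1987RG1, (0.21) p.256, (2.9) p.266, Thm 3 p.264, (1.22) p.264, Lemma 4 p.280; Balaban1985RegularSpaces, Thm 2 p.83; Balaban1988RG2Cluster, Lemmas 1–3 pp.9–20; Balaban1985UV3, Thm 1 p.257 (bookkeeping + elementary window)] -/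
theorem stabilityBR13Sep_thetaShape18_pinX3_of_leaves_theta13LiveOfNumerics {n : Stage12Numerics} {ε₂₉ : ℝ} (hn : n.Pos) (hε' : 0 < ε₂₉) (hκ : 0 ≤ n.s2.lf.κ) (hE₀ : 0 ≤ n.s2.lf.E₀)
    (hB₀ : 0 ≤ n.s2.lf.B₀) (ζ : ZetaOfRecord F N n.ν n.τ9.M) (Rz : (K : ℕ) → Sect2.Residual (F.P K) (MatA N)) (Zt : (K : ℕ) → TkResidualW F N (FluctV N) K)
    (hP : (theta13LiveOfNumerics F N n ε₂₉ ζ Rz Zt).Provisos₁₃Sep F N) (hZ : (theta13LiveOfNumerics F N n ε₂₉ ζ Rz Zt).ZtUnity F N)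
    (lam8 : ResidB8 (theta13LiveOfNumerics F N n ε₂₉ ζ Rz Zt).toStage3Params) (lam12 : ResidB12 F N (theta13LiveOfNumerics F N n ε₂₉ ζ Rz Zt).τ9.M) (lam13 : B12.RunParams → ResidB13 (theta13LiveOfNumerics F N n ε₂₉ ζ Rz Zt).toStage3Params)
    (Mstar : ℕ) (ops : OpsY N (theta13LiveOfNumerics F N n ε₂₉ ζ Rz Zt).toStage3Params Mstar) (ζ9 : ResidZ F N) (lamW : ResidW F N) (w : WorldP)
    (hC : w.C = (datumOfRecord₁₃Sep F N (theta13LiveOfNumerics F N n ε₂₉ ζ Rz Zt) hP).C) (hγ : 0 < w.γ ∧ w.γ ≤ (theta13LiveOfNumerics F N n ε₂₉ ζ Rz Zt).γ)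
    (hL : w.L = ((theta13LiveOfNumerics F N n ε₂₉ ζ Rz Zt).L : ℝ))
    (hup : ∀ P, w.up P = upOfRecord₅C F N (((theta13LiveOfNumerics F N n ε₂₉ ζ Rz Zt).pinX3 F N lam8 lam12 lam13).view₁₃B10YZW F N Mstar ops ζ9 lamW) P)
    (h05 : ∀ P : B12.RunParams, B8LeafR (theta13LiveOfNumerics F N n ε₂₉ ζ Rz Zt).D ((theta13LiveOfNumerics F N n ε₂₉ ζ Rz Zt).L : ℝ) lam8.C₂ lam8.B₁' lam8.inp.B₀' lam8.B₁ lam8.B₂ lam8.c₁ lam8.inp lam8.B₀β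
      (B8Lemma1NonAbelian.blockPairNA (theta13LiveOfNumerics F N n ε₂₉ ζ Rz Zt).D (theta13LiveOfNumerics F N n ε₂₉ ζ Rz Zt).L (theta13LiveOfNumerics F N n ε₂₉ ζ Rz Zt).𝔸) (fun j : IdxB8SubB (theta13LiveOfNumerics F N n ε₂₉ ζ Rz Zt).toStage3Params => famB8OfRecordSubB (theta13LiveOfNumerics F N n ε₂₉ ζ Rz Zt).toStage3Params lam8.β lam8.len j)
      lam8.lan lam8.cub (fun j => lam8.toAxial j.1))
    (h06 : B9LeafX (Y9OfRecord N (theta13LiveOfNumerics F N n ε₂₉ ζ Rz Zt).toStage3Params Mstar ops)) (h07 : B11Leaf (Z11OfRecord F N ζ9))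
    (h08 : PrintedUV3V N (theta13LiveOfNumerics F N n ε₂₉ ζ Rz Zt).L)
    (h09 : ∀ P : B12.RunParams, B12Sec2to5.Lemma4Printed (F12OfRecord₁₂ F N (theta13LiveOfNumerics F N n ε₂₉ ζ Rz Zt).toStage12Params lam12 P) (lam12 P).consts)
    (h09T : ∀ P : B12.RunParams, (leavesP w P).smallCouplings → (leavesP w P).smallFieldInductive)
    (h10 : ∀ P : B12.RunParams, B13LeafOfRecord (theta13LiveOfNumerics F N n ε₂₉ ζ Rz Zt).toStage3Params (lam13 P))
    (h11 : ∀ P : B12.RunParams, (leavesP w P).b7 → (leavesP w P).b8 → (leavesP w P).b9 → (leavesP w P).b10 → (leavesP w P).b11 →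
      (leavesP w P).smallCouplings → (leavesP w P).smallFieldInductive → (leavesP w P).flowControl →
        ∀ k, k < P.K → SLaw₁₃ F N (theta13LiveOfNumerics F N n ε₂₉ ζ Rz Zt) P k → TLaw₁₃ F N (theta13LiveOfNumerics F N n ε₂₉ ζ Rz Zt) P k)
    (h12 : ∀ P : B12.RunParams, B15Leaf (WOfRecord₁₃ F N (theta13LiveOfNumerics F N n ε₂₉ ζ Rz Zt) lamW P))
    (hUV : ∀ P : B12.RunParams, (genFlow (betaOfRecord₁₃ F N (theta13LiveOfNumerics F N n ε₂₉ ζ Rz Zt)) P.g0).InInterval w.γ P.K → ∀ k, k ≤ P.K → SLaw₁₃ F N (theta13LiveOfNumerics F N n ε₂₉ ζ Rz Zt) P k →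
      ∀ U : GaugeField (F.P P.K) k (SU N),
        chiβOfRecord₁₃ F N (theta13LiveOfNumerics F N n ε₂₉ ζ Rz Zt) P.K (gOfRecord₁₃ F N (theta13LiveOfNumerics F N n ε₂₉ ζ Rz Zt) P) k U *
              Real.exp (-(1 / (gOfRecord₁₃ F N (theta13LiveOfNumerics F N n ε₂₉ ζ Rz Zt) P k) ^ 2 * wilsonBGOfRecord F N (theta13LiveOfNumerics F N n ε₂₉ ζ Rz Zt).εbg P k U)
                - w.em (gOfRecord₁₃ F N (theta13LiveOfNumerics F N n ε₂₉ ζ Rz Zt) P k) * (Fintype.card (Site (F.P P.K) k) : ℝ)) ≤ densOfRecord₁₃ F N (theta13LiveOfNumerics F N n ε₂₉ ζ Rz Zt) P k U ∧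
        densOfRecord₁₃ F N (theta13LiveOfNumerics F N n ε₂₉ ζ Rz Zt) P k U ≤ Real.exp (w.ep (gOfRecord₁₃ F N (theta13LiveOfNumerics F N n ε₂₉ ζ Rz Zt) P k) * (Fintype.card (Site (F.P P.K) k) : ℝ)))
    (hlo : BetaLowerH w.b w.γ (datumOfRecord₁₃Sep F N (theta13LiveOfNumerics F N n ε₂₉ ζ Rz Zt) hP).βfun)
    (hhi : BetaUpperH w.βup w.γ (datumOfRecord₁₃Sep F N (theta13LiveOfNumerics F N n ε₂₉ ζ Rz Zt) hP).βfun) :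
    ∃ (θ' : Stage13Params F N) (h' : θ'.Provisos₁₃Sep F N), (θ'.ZtUnity F N ∧ θ'.SlotsNondegenerate₁₃ F N) ∧ θ'.Admissible F N ∧
      B16.EndStatementBPrinted (datumOfRecord₁₃Sep F N θ' h').C ∧
      ∃ γ₁ : ℝ, 0 < γ₁ ∧ ∀ γ : ℝ, 0 < γ → γ ≤ γ₁ → ∃ P : B12.RunParams, 1 ≤ P.K ∧ ((datumOfRecord₁₃Sep F N θ' h').C P).flow.InInterval γ P.K :=
  N24_stabilityBR13Sep_thetaShape18_rebindX_fourPin_pointed_theta13LiveOfNumerics hn hε' hκ hE₀ hB₀ ζ Rz Zt hP hZ (XPinned₁₃ F N (theta13LiveOfNumerics F N n ε₂₉ ζ Rz Zt) lam8 lam12 lam13) Mstar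
    ops ζ9 lamW w hC hγ hL hup (fun P => (socket05_pinX3_iff F N (theta13LiveOfNumerics F N n ε₂₉ ζ Rz Zt) lam8 lam12 lam13 P).2 (h05 P)) h06 h07 h08 (fun P => (socket09_pinX3_iff F N
    (theta13LiveOfNumerics F N n ε₂₉ ζ Rz Zt) lam8 lam12 lam13 P).2 (h09 P)) h09T (fun P _ _ _ _ => (socket10_pinX3_iff F N (theta13LiveOfNumerics F N n ε₂₉ ζ Rz Zt) lam8 lam12 lam13 P).2 (h10
    P)) h11 h12 hUV hlo hhi

/-- **THE ∃-BODY OF `BetaWindowAtSomeRecord13` WITNESSED BY `(theta13LiveOfNumerics F N n ε₂₉ ζ Rz Zt, hP, w)`, children over the four-pin view of its X-pinned parameter, N05 ∕ N09 ∕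
N10 ← their leaves of record** (module 44⁗ §1 at `X' := XPinned₁₃ F N θL lam8 lam12 lam13`).  COMPOSITE; NOT the stub. [cite: Balaban1989LargeFieldII, Thm 1 p.355, (0.1) pp.355–356, p.391; Balaban1988Convergent, p.244, Thm 2 p.263, (2.4) p.255, (2.18) p.257, (2.28) p.259, (3.16)–(3.22) pp.268–269; Balaban1989LargeFieldI, (0.2)–(0.4) p.176; Balaban1987RG1, (0.21) p.256, (2.9) p.266, Thm 3 p.264, (1.22) p.264, Lemma 4 p.280; Balaban1985RegularSpaces, Thm 2 p.83; Balaban1988RG2Cluster, Lemmas 1–3 pp.9–20; Balaban1985UV3, Thm 1 p.257 (bookkeeping + elementary window)] -/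
theorem betaWindowAtSomeRecord₁₃Sep_pinX3_of_leaves_theta13LiveOfNumerics_of_boxH {n : Stage12Numerics} {ε₂₉ : ℝ} (hn : n.Pos) (hε' : 0 < ε₂₉) (hκ : 0 ≤ n.s2.lf.κ) (hE₀ : 0 ≤ n.s2.lf.E₀)
    (hB₀ : 0 ≤ n.s2.lf.B₀) (ζ : ZetaOfRecord F N n.ν n.τ9.M) (Rz : (K : ℕ) → Sect2.Residual (F.P K) (MatA N)) (Zt : (K : ℕ) → TkResidualW F N (FluctV N) K)
    (hP : (theta13LiveOfNumerics F N n ε₂₉ ζ Rz Zt).Provisos₁₃Sep F N) (hZ : (theta13LiveOfNumerics F N n ε₂₉ ζ Rz Zt).ZtUnity F N)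
    (lam8 : ResidB8 (theta13LiveOfNumerics F N n ε₂₉ ζ Rz Zt).toStage3Params) (lam12 : ResidB12 F N (theta13LiveOfNumerics F N n ε₂₉ ζ Rz Zt).τ9.M) (lam13 : B12.RunParams → ResidB13 (theta13LiveOfNumerics F N n ε₂₉ ζ Rz Zt).toStage3Params)
    (Mstar : ℕ) (ops : OpsY N (theta13LiveOfNumerics F N n ε₂₉ ζ Rz Zt).toStage3Params Mstar) (ζ9 : ResidZ F N) (lamW : ResidW F N) (w : WorldP)
    (hC : w.C = (datumOfRecord₁₃Sep F N (theta13LiveOfNumerics F N n ε₂₉ ζ Rz Zt) hP).C) (hγ : 0 < w.γ ∧ w.γ ≤ (theta13LiveOfNumerics F N n ε₂₉ ζ Rz Zt).γ)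
    (hL : w.L = ((theta13LiveOfNumerics F N n ε₂₉ ζ Rz Zt).L : ℝ))
    (hup : ∀ P, w.up P = upOfRecord₅C F N (((theta13LiveOfNumerics F N n ε₂₉ ζ Rz Zt).pinX3 F N lam8 lam12 lam13).view₁₃B10YZW F N Mstar ops ζ9 lamW) P)
    (h05 : ∀ P : B12.RunParams, B8LeafR (theta13LiveOfNumerics F N n ε₂₉ ζ Rz Zt).D ((theta13LiveOfNumerics F N n ε₂₉ ζ Rz Zt).L : ℝ) lam8.C₂ lam8.B₁' lam8.inp.B₀' lam8.B₁ lam8.B₂ lam8.c₁ lam8.inp lam8.B₀β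
      (B8Lemma1NonAbelian.blockPairNA (theta13LiveOfNumerics F N n ε₂₉ ζ Rz Zt).D (theta13LiveOfNumerics F N n ε₂₉ ζ Rz Zt).L (theta13LiveOfNumerics F N n ε₂₉ ζ Rz Zt).𝔸) (fun j : IdxB8SubB (theta13LiveOfNumerics F N n ε₂₉ ζ Rz Zt).toStage3Params => famB8OfRecordSubB (theta13LiveOfNumerics F N n ε₂₉ ζ Rz Zt).toStage3Params lam8.β lam8.len j)
      lam8.lan lam8.cub (fun j => lam8.toAxial j.1))
    (h06 : B9LeafX (Y9OfRecord N (theta13LiveOfNumerics F N n ε₂₉ ζ Rz Zt).toStage3Params Mstar ops)) (h07 : B11Leaf (Z11OfRecord F N ζ9))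
    (h08 : PrintedUV3V N (theta13LiveOfNumerics F N n ε₂₉ ζ Rz Zt).L)
    (h09 : ∀ P : B12.RunParams, B12Sec2to5.Lemma4Printed (F12OfRecord₁₂ F N (theta13LiveOfNumerics F N n ε₂₉ ζ Rz Zt).toStage12Params lam12 P) (lam12 P).consts)
    (h09T : ∀ P : B12.RunParams, (leavesP w P).smallCouplings → (leavesP w P).smallFieldInductive)
    (h10 : ∀ P : B12.RunParams, B13LeafOfRecord (theta13LiveOfNumerics F N n ε₂₉ ζ Rz Zt).toStage3Params (lam13 P))
    (h11 : ∀ P : B12.RunParams, (leavesP w P).b7 → (leavesP w P).b8 → (leavesP w P).b9 → (leavesP w P).b10 → (leavesP w P).b11 →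
      (leavesP w P).smallCouplings → (leavesP w P).smallFieldInductive → (leavesP w P).flowControl →
        ∀ k, k < P.K → SLaw₁₃ F N (theta13LiveOfNumerics F N n ε₂₉ ζ Rz Zt) P k → TLaw₁₃ F N (theta13LiveOfNumerics F N n ε₂₉ ζ Rz Zt) P k)
    (h12 : ∀ P : B12.RunParams, B15Leaf (WOfRecord₁₃ F N (theta13LiveOfNumerics F N n ε₂₉ ζ Rz Zt) lamW P))
    (hUV : ∀ P : B12.RunParams, (genFlow (betaOfRecord₁₃ F N (theta13LiveOfNumerics F N n ε₂₉ ζ Rz Zt)) P.g0).InInterval w.γ P.K → ∀ k, k ≤ P.K → SLaw₁₃ F N (theta13LiveOfNumerics F N n ε₂₉ ζ Rz Zt) P k →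
      ∀ U : GaugeField (F.P P.K) k (SU N),
        chiβOfRecord₁₃ F N (theta13LiveOfNumerics F N n ε₂₉ ζ Rz Zt) P.K (gOfRecord₁₃ F N (theta13LiveOfNumerics F N n ε₂₉ ζ Rz Zt) P) k U *
              Real.exp (-(1 / (gOfRecord₁₃ F N (theta13LiveOfNumerics F N n ε₂₉ ζ Rz Zt) P k) ^ 2 * wilsonBGOfRecord F N (theta13LiveOfNumerics F N n ε₂₉ ζ Rz Zt).εbg P k U)
                - w.em (gOfRecord₁₃ F N (theta13LiveOfNumerics F N n ε₂₉ ζ Rz Zt) P k) * (Fintype.card (Site (F.P P.K) k) : ℝ)) ≤ densOfRecord₁₃ F N (theta13LiveOfNumerics F N n ε₂₉ ζ Rz Zt) P k U ∧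
        densOfRecord₁₃ F N (theta13LiveOfNumerics F N n ε₂₉ ζ Rz Zt) P k U ≤ Real.exp (w.ep (gOfRecord₁₃ F N (theta13LiveOfNumerics F N n ε₂₉ ζ Rz Zt) P k) * (Fintype.card (Site (F.P P.K) k) : ℝ)))
    (hlo : BetaLowerH w.b w.γ (datumOfRecord₁₃Sep F N (theta13LiveOfNumerics F N n ε₂₉ ζ Rz Zt) hP).βfun)
    (hhi : BetaUpperH w.βup w.γ (datumOfRecord₁₃Sep F N (theta13LiveOfNumerics F N n ε₂₉ ζ Rz Zt) hP).βfun) :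
    ∃ (θ' : Stage13Params F N) (h' : θ'.Provisos₁₃Sep F N) (w' : WorldP), (θ'.ZtUnity F N ∧ θ'.SlotsNondegenerate₁₃ F N) ∧ θ'.Admissible F N ∧
      IsRecordOfRecord₁₃CSep F N (datumOfRecord₁₃Sep F N θ' h') w' ∧ (∀ P : B12.RunParams, Nodes (leavesP w' P)) ∧
      BetaBoundsInInterval w'.C.toB12 w'.γ w'.b w'.βup ∧
      ∃ γ₁ : ℝ, 0 < γ₁ ∧ ∀ γ : ℝ, 0 < γ → γ ≤ γ₁ → ∃ P : B12.RunParams, 1 ≤ P.K ∧ ((datumOfRecord₁₃Sep F N θ' h').C P).flow.InInterval γ P.K :=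
  N24_betaWindowAtSomeRecord₁₃Sep_of_rebindX_fourPin_pointed_theta13LiveOfNumerics_of_boxH hn hε' hκ hE₀ hB₀ ζ Rz Zt hP hZ (XPinned₁₃ F N (theta13LiveOfNumerics F N n ε₂₉ ζ Rz Zt) lam8 lam12
    lam13) Mstar ops ζ9 lamW w hC hγ hL hup (fun P => (socket05_pinX3_iff F N (theta13LiveOfNumerics F N n ε₂₉ ζ Rz Zt) lam8 lam12 lam13 P).2 (h05 P)) h06 h07 h08 (fun P => (socket09_pinX3_iff F
    N (theta13LiveOfNumerics F N n ε₂₉ ζ Rz Zt) lam8 lam12 lam13 P).2 (h09 P)) h09T (fun P _ _ _ _ => (socket10_pinX3_iff F N (theta13LiveOfNumerics F N n ε₂₉ ζ Rz Zt) lam8 lam12 lam13 P).2 (h10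
    P)) h11 h12 hUV hlo hhi

/-- **★ ITEM K1⁗'s θ-KEYED CONSEQUENT WITNESSED BY K0a's OPEN-LETTER MEMBER `(theta13LiveOfFamily₂ F N ε₀ ε₂₉ ζ Rz Zt, hP)`** (the live witness of record `theta13LiveOfRecord F N` is its
`(1, ⅛)` member, K0a `theta13LiveOfRecord_eq_family₂`), **CHILDREN OVER THE FOUR-PIN VIEW OF ITS X-PINNED PARAMETER, N05 ∕ N09 ∕ N10 ← THEIR LEAVES OF RECORD** (module 44⁗ §2 at
`X' := XPinned₁₃ F N θ lam8 lam12 lam13`; `hε hε' hP hZ` displayed as there).  COMPOSITE; NOT the stub. [cite: Balaban1989LargeFieldII, Thm 1 p.355, (0.1) pp.355–356, p.391; Balaban1988Convergent, p.244, Thm 2 p.263, (2.4) p.255, (2.18) p.257, (2.28) p.259, (3.16)–(3.22) pp.268–269; Balaban1989LargeFieldI, (0.2)–(0.4) p.176; Balaban1987RG1, (0.21) p.256, (2.9) p.266, Thm 3 p.264, (1.22) p.264, Lemma 4 p.280; Balaban1985RegularSpaces, Thm 2 p.83; Balaban1988RG2Cluster, Lemmas 1–3 pp.9–20; Balaban1985UV3,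 Thm 1 p.257 (bookkeeping + elementary window)] -/
theorem stabilityBR13Sep_thetaShape18_pinX3_of_leaves_theta13LiveOfFamily₂ {ε₀ ε₂₉ : ℝ} (hε : 0 < ε₀) (hε' : 0 < ε₂₉) (ζ : ZetaOfRecord F N (numerics7OfFamily ε₀) 1)
    (Rz : (K : ℕ) → Sect2.Residual (F.P K) (MatA N)) (Zt : (K : ℕ) → TkResidualW F N (FluctV N) K) (hP : (theta13LiveOfFamily₂ F N ε₀ ε₂₉ ζ Rz Zt).Provisos₁₃Sep F N)
    (hZ : (theta13LiveOfFamily₂ F N ε₀ ε₂₉ ζ Rz Zt).ZtUnity F N)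
    (lam8 : ResidB8 (theta13LiveOfFamily₂ F N ε₀ ε₂₉ ζ Rz Zt).toStage3Params) (lam12 : ResidB12 F N (theta13LiveOfFamily₂ F N ε₀ ε₂₉ ζ Rz Zt).τ9.M) (lam13 : B12.RunParams → ResidB13 (theta13LiveOfFamily₂ F N ε₀ ε₂₉ ζ Rz Zt).toStage3Params)
    (Mstar : ℕ) (ops : OpsY N (theta13LiveOfFamily₂ F N ε₀ ε₂₉ ζ Rz Zt).toStage3Params Mstar) (ζ9 : ResidZ F N) (lamW : ResidW F N) (w : WorldP)
    (hC : w.C = (datumOfRecord₁₃Sep F N (theta13LiveOfFamily₂ F N ε₀ ε₂₉ ζ Rz Zt) hP).C) (hγ : 0 < w.γ ∧ w.γ ≤ (theta13LiveOfFamily₂ F N ε₀ ε₂₉ ζ Rz Zt).γ)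
    (hL : w.L = ((theta13LiveOfFamily₂ F N ε₀ ε₂₉ ζ Rz Zt).L : ℝ))
    (hup : ∀ P, w.up P = upOfRecord₅C F N (((theta13LiveOfFamily₂ F N ε₀ ε₂₉ ζ Rz Zt).pinX3 F N lam8 lam12 lam13).view₁₃B10YZW F N Mstar ops ζ9 lamW) P)
    (h05 : ∀ P : B12.RunParams, B8LeafR (theta13LiveOfFamily₂ F N ε₀ ε₂₉ ζ Rz Zt).D ((theta13LiveOfFamily₂ F N ε₀ ε₂₉ ζ Rz Zt).L : ℝ) lam8.C₂ lam8.B₁' lam8.inp.B₀' lam8.B₁ lam8.B₂ lam8.c₁ lam8.inp lam8.B₀β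
      (B8Lemma1NonAbelian.blockPairNA (theta13LiveOfFamily₂ F N ε₀ ε₂₉ ζ Rz Zt).D (theta13LiveOfFamily₂ F N ε₀ ε₂₉ ζ Rz Zt).L (theta13LiveOfFamily₂ F N ε₀ ε₂₉ ζ Rz Zt).𝔸) (fun j : IdxB8SubB (theta13LiveOfFamily₂ F N ε₀ ε₂₉ ζ Rz Zt).toStage3Params => famB8OfRecordSubB (theta13LiveOfFamily₂ F N ε₀ ε₂₉ ζ Rz Zt).toStage3Params lam8.β lam8.len j)
      lam8.lan lam8.cub (fun j => lam8.toAxial j.1))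
    (h06 : B9LeafX (Y9OfRecord N (theta13LiveOfFamily₂ F N ε₀ ε₂₉ ζ Rz Zt).toStage3Params Mstar ops)) (h07 : B11Leaf (Z11OfRecord F N ζ9))
    (h08 : PrintedUV3V N (theta13LiveOfFamily₂ F N ε₀ ε₂₉ ζ Rz Zt).L)
    (h09 : ∀ P : B12.RunParams, B12Sec2to5.Lemma4Printed (F12OfRecord₁₂ F N (theta13LiveOfFamily₂ F N ε₀ ε₂₉ ζ Rz Zt).toStage12Params lam12 P) (lam12 P).consts)
    (h09T : ∀ P : B12.RunParams, (leavesP w P).smallCouplings → (leavesP w P).smallFieldInductive)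
    (h10 : ∀ P : B12.RunParams, B13LeafOfRecord (theta13LiveOfFamily₂ F N ε₀ ε₂₉ ζ Rz Zt).toStage3Params (lam13 P))
    (h11 : ∀ P : B12.RunParams, (leavesP w P).b7 → (leavesP w P).b8 → (leavesP w P).b9 → (leavesP w P).b10 → (leavesP w P).b11 →
      (leavesP w P).smallCouplings → (leavesP w P).smallFieldInductive → (leavesP w P).flowControl →
        ∀ k, k < P.K → SLaw₁₃ F N (theta13LiveOfFamily₂ F N ε₀ ε₂₉ ζ Rz Zt) P k → TLaw₁₃ F N (theta13LiveOfFamily₂ F N ε₀ ε₂₉ ζ Rz Zt) P k)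
    (h12 : ∀ P : B12.RunParams, B15Leaf (WOfRecord₁₃ F N (theta13LiveOfFamily₂ F N ε₀ ε₂₉ ζ Rz Zt) lamW P))
    (hUV : ∀ P : B12.RunParams, (genFlow (betaOfRecord₁₃ F N (theta13LiveOfFamily₂ F N ε₀ ε₂₉ ζ Rz Zt)) P.g0).InInterval w.γ P.K → ∀ k, k ≤ P.K → SLaw₁₃ F N (theta13LiveOfFamily₂ F N ε₀ ε₂₉ ζ Rz Zt) P k →
      ∀ U : GaugeField (F.P P.K) k (SU N),
        chiβOfRecord₁₃ F N (theta13LiveOfFamily₂ F N ε₀ ε₂₉ ζ Rz Zt) P.K (gOfRecord₁₃ F N (theta13LiveOfFamily₂ F N ε₀ ε₂₉ ζ Rz Zt) P) k U *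
              Real.exp (-(1 / (gOfRecord₁₃ F N (theta13LiveOfFamily₂ F N ε₀ ε₂₉ ζ Rz Zt) P k) ^ 2 * wilsonBGOfRecord F N (theta13LiveOfFamily₂ F N ε₀ ε₂₉ ζ Rz Zt).εbg P k U)
                - w.em (gOfRecord₁₃ F N (theta13LiveOfFamily₂ F N ε₀ ε₂₉ ζ Rz Zt) P k) * (Fintype.card (Site (F.P P.K) k) : ℝ)) ≤ densOfRecord₁₃ F N (theta13LiveOfFamily₂ F N ε₀ ε₂₉ ζ Rz Zt) P k U ∧
        densOfRecord₁₃ F N (theta13LiveOfFamily₂ F N ε₀ ε₂₉ ζ Rz Zt) P k U ≤ Real.exp (w.ep (gOfRecord₁₃ F N (theta13LiveOfFamily₂ F N ε₀ ε₂₉ ζ Rz Zt) P k) * (Fintype.card (Site (F.P P.K) k) : ℝ)))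
    (hlo : BetaLowerH w.b w.γ (datumOfRecord₁₃Sep F N (theta13LiveOfFamily₂ F N ε₀ ε₂₉ ζ Rz Zt) hP).βfun)
    (hhi : BetaUpperH w.βup w.γ (datumOfRecord₁₃Sep F N (theta13LiveOfFamily₂ F N ε₀ ε₂₉ ζ Rz Zt) hP).βfun) :
    ∃ (θ' : Stage13Params F N) (h' : θ'.Provisos₁₃Sep F N), (θ'.ZtUnity F N ∧ θ'.SlotsNondegenerate₁₃ F N) ∧ θ'.Admissible F N ∧
      B16.EndStatementBPrinted (datumOfRecord₁₃Sep F N θ' h').C ∧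
      ∃ γ₁ : ℝ, 0 < γ₁ ∧ ∀ γ : ℝ, 0 < γ → γ ≤ γ₁ → ∃ P : B12.RunParams, 1 ≤ P.K ∧ ((datumOfRecord₁₃Sep F N θ' h').C P).flow.InInterval γ P.K :=
  N24_stabilityBR13Sep_thetaShape18_rebindX_fourPin_pointed_theta13LiveOfFamily₂ hε hε' ζ Rz Zt hP hZ (XPinned₁₃ F N (theta13LiveOfFamily₂ F N ε₀ ε₂₉ ζ Rz Zt) lam8 lam12 lam13) Mstar ops ζ9 lamW
    w hC hγ hL hup (fun P => (socket05_pinX3_iff F N (theta13LiveOfFamily₂ F N ε₀ ε₂₉ ζ Rz Zt) lam8 lam12 lam13 P).2 (h05 P)) h06 h07 h08 (fun P => (socket09_pinX3_iff F N (theta13LiveOfFamily₂ F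
    N ε₀ ε₂₉ ζ Rz Zt) lam8 lam12 lam13 P).2 (h09 P)) h09T (fun P _ _ _ _ => (socket10_pinX3_iff F N (theta13LiveOfFamily₂ F N ε₀ ε₂₉ ζ Rz Zt) lam8 lam12 lam13 P).2 (h10 P)) h11 h12 hUV hlo hhi

/-- **THE ∃-BODY OF `BetaWindowAtSomeRecord13` WITNESSED BY `(theta13LiveOfFamily₂ F N ε₀ ε₂₉ ζ Rz Zt, hP, w)`, children over the four-pin view of its X-pinned parameter, N05 ∕ N09 ∕
N10 ← their leaves of record** (module 44⁗ §2 at `X' := XPinned₁₃ F N θ lam8 lam12 lam13`).  COMPOSITE; NOT the stub. [cite: Balaban1989LargeFieldII, Thm 1 p.355, (0.1) pp.355–356, p.391; Balaban1988Convergent, p.244, Thm 2 p.263, (2.4) p.255, (2.18) p.257, (2.28) p.259, (3.16)–(3.22) pp.268–269; Balaban1989LargeFieldI, (0.2)–(0.4) p.176; Balaban1987RG1, (0.21) p.256, (2.9) p.266, Thm 3 p.264, (1.22) p.264, Lemma 4 p.280; Balaban1985RegularSpaces, Thm 2 p.83; Balaban1988RG2Cluster, Lemmas 1–3 pp.9–20;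 Balaban1985UV3, Thm 1 p.257 (bookkeeping + elementary window)] -/
theorem betaWindowAtSomeRecord₁₃Sep_pinX3_of_leaves_theta13LiveOfFamily₂_of_boxH {ε₀ ε₂₉ : ℝ} (hε : 0 < ε₀) (hε' : 0 < ε₂₉) (ζ : ZetaOfRecord F N (numerics7OfFamily ε₀) 1)
    (Rz : (K : ℕ) → Sect2.Residual (F.P K) (MatA N)) (Zt : (K : ℕ) → TkResidualW F N (FluctV N) K) (hP : (theta13LiveOfFamily₂ F N ε₀ ε₂₉ ζ Rz Zt).Provisos₁₃Sep F N)
    (hZ : (theta13LiveOfFamily₂ F N ε₀ ε₂₉ ζ Rz Zt).ZtUnity F N)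
    (lam8 : ResidB8 (theta13LiveOfFamily₂ F N ε₀ ε₂₉ ζ Rz Zt).toStage3Params) (lam12 : ResidB12 F N (theta13LiveOfFamily₂ F N ε₀ ε₂₉ ζ Rz Zt).τ9.M) (lam13 : B12.RunParams → ResidB13 (theta13LiveOfFamily₂ F N ε₀ ε₂₉ ζ Rz Zt).toStage3Params)
    (Mstar : ℕ) (ops : OpsY N (theta13LiveOfFamily₂ F N ε₀ ε₂₉ ζ Rz Zt).toStage3Params Mstar) (ζ9 : ResidZ F N) (lamW : ResidW F N) (w : WorldP)
    (hC : w.C = (datumOfRecord₁₃Sep F N (theta13LiveOfFamily₂ F N ε₀ ε₂₉ ζ Rz Zt) hP).C) (hγ : 0 < w.γ ∧ w.γ ≤ (theta13LiveOfFamily₂ F N ε₀ ε₂₉ ζ Rz Zt).γ)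
    (hL : w.L = ((theta13LiveOfFamily₂ F N ε₀ ε₂₉ ζ Rz Zt).L : ℝ))
    (hup : ∀ P, w.up P = upOfRecord₅C F N (((theta13LiveOfFamily₂ F N ε₀ ε₂₉ ζ Rz Zt).pinX3 F N lam8 lam12 lam13).view₁₃B10YZW F N Mstar ops ζ9 lamW) P)
    (h05 : ∀ P : B12.RunParams, B8LeafR (theta13LiveOfFamily₂ F N ε₀ ε₂₉ ζ Rz Zt).D ((theta13LiveOfFamily₂ F N ε₀ ε₂₉ ζ Rz Zt).L : ℝ) lam8.C₂ lam8.B₁' lam8.inp.B₀' lam8.B₁ lam8.B₂ lam8.c₁ lam8.inp lam8.B₀β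
      (B8Lemma1NonAbelian.blockPairNA (theta13LiveOfFamily₂ F N ε₀ ε₂₉ ζ Rz Zt).D (theta13LiveOfFamily₂ F N ε₀ ε₂₉ ζ Rz Zt).L (theta13LiveOfFamily₂ F N ε₀ ε₂₉ ζ Rz Zt).𝔸) (fun j : IdxB8SubB (theta13LiveOfFamily₂ F N ε₀ ε₂₉ ζ Rz Zt).toStage3Params => famB8OfRecordSubB (theta13LiveOfFamily₂ F N ε₀ ε₂₉ ζ Rz Zt).toStage3Params lam8.β lam8.len j)
      lam8.lan lam8.cub (fun j => lam8.toAxial j.1))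
    (h06 : B9LeafX (Y9OfRecord N (theta13LiveOfFamily₂ F N ε₀ ε₂₉ ζ Rz Zt).toStage3Params Mstar ops)) (h07 : B11Leaf (Z11OfRecord F N ζ9))
    (h08 : PrintedUV3V N (theta13LiveOfFamily₂ F N ε₀ ε₂₉ ζ Rz Zt).L)
    (h09 : ∀ P : B12.RunParams, B12Sec2to5.Lemma4Printed (F12OfRecord₁₂ F N (theta13LiveOfFamily₂ F N ε₀ ε₂₉ ζ Rz Zt).toStage12Params lam12 P) (lam12 P).consts)
    (h09T : ∀ P : B12.RunParams, (leavesP w P).smallCouplings → (leavesP w P).smallFieldInductive)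
    (h10 : ∀ P : B12.RunParams, B13LeafOfRecord (theta13LiveOfFamily₂ F N ε₀ ε₂₉ ζ Rz Zt).toStage3Params (lam13 P))
    (h11 : ∀ P : B12.RunParams, (leavesP w P).b7 → (leavesP w P).b8 → (leavesP w P).b9 → (leavesP w P).b10 → (leavesP w P).b11 →
      (leavesP w P).smallCouplings → (leavesP w P).smallFieldInductive → (leavesP w P).flowControl →
        ∀ k, k < P.K → SLaw₁₃ F N (theta13LiveOfFamily₂ F N ε₀ ε₂₉ ζ Rz Zt) P k → TLaw₁₃ F N (theta13LiveOfFamily₂ F N ε₀ ε₂₉ ζ Rz Zt) P k)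
    (h12 : ∀ P : B12.RunParams, B15Leaf (WOfRecord₁₃ F N (theta13LiveOfFamily₂ F N ε₀ ε₂₉ ζ Rz Zt) lamW P))
    (hUV : ∀ P : B12.RunParams, (genFlow (betaOfRecord₁₃ F N (theta13LiveOfFamily₂ F N ε₀ ε₂₉ ζ Rz Zt)) P.g0).InInterval w.γ P.K → ∀ k, k ≤ P.K → SLaw₁₃ F N (theta13LiveOfFamily₂ F N ε₀ ε₂₉ ζ Rz Zt) P k →
      ∀ U : GaugeField (F.P P.K) k (SU N),
        chiβOfRecord₁₃ F N (theta13LiveOfFamily₂ F N ε₀ ε₂₉ ζ Rz Zt) P.K (gOfRecord₁₃ F N (theta13LiveOfFamily₂ F N ε₀ ε₂₉ ζ Rz Zt) P) k U *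
              Real.exp (-(1 / (gOfRecord₁₃ F N (theta13LiveOfFamily₂ F N ε₀ ε₂₉ ζ Rz Zt) P k) ^ 2 * wilsonBGOfRecord F N (theta13LiveOfFamily₂ F N ε₀ ε₂₉ ζ Rz Zt).εbg P k U)
                - w.em (gOfRecord₁₃ F N (theta13LiveOfFamily₂ F N ε₀ ε₂₉ ζ Rz Zt) P k) * (Fintype.card (Site (F.P P.K) k) : ℝ)) ≤ densOfRecord₁₃ F N (theta13LiveOfFamily₂ F N ε₀ ε₂₉ ζ Rz Zt) P k U ∧
        densOfRecord₁₃ F N (theta13LiveOfFamily₂ F N ε₀ ε₂₉ ζ Rz Zt) P k U ≤ Real.exp (w.ep (gOfRecord₁₃ F N (theta13LiveOfFamily₂ F N ε₀ ε₂₉ ζ Rz Zt) P k) * (Fintype.card (Site (F.P P.K) k) : ℝ)))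
    (hlo : BetaLowerH w.b w.γ (datumOfRecord₁₃Sep F N (theta13LiveOfFamily₂ F N ε₀ ε₂₉ ζ Rz Zt) hP).βfun)
    (hhi : BetaUpperH w.βup w.γ (datumOfRecord₁₃Sep F N (theta13LiveOfFamily₂ F N ε₀ ε₂₉ ζ Rz Zt) hP).βfun) :
    ∃ (θ' : Stage13Params F N) (h' : θ'.Provisos₁₃Sep F N) (w' : WorldP), (θ'.ZtUnity F N ∧ θ'.SlotsNondegenerate₁₃ F N) ∧ θ'.Admissible F N ∧
      IsRecordOfRecord₁₃CSep F N (datumOfRecord₁₃Sep F N θ' h') w' ∧ (∀ P : B12.RunParams, Nodes (leavesP w' P)) ∧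
      BetaBoundsInInterval w'.C.toB12 w'.γ w'.b w'.βup ∧
      ∃ γ₁ : ℝ, 0 < γ₁ ∧ ∀ γ : ℝ, 0 < γ → γ ≤ γ₁ → ∃ P : B12.RunParams, 1 ≤ P.K ∧ ((datumOfRecord₁₃Sep F N θ' h').C P).flow.InInterval γ P.K :=
  N24_betaWindowAtSomeRecord₁₃Sep_of_rebindX_fourPin_pointed_theta13LiveOfFamily₂_of_boxH hε hε' ζ Rz Zt hP hZ (XPinned₁₃ F N (theta13LiveOfFamily₂ F N ε₀ ε₂₉ ζ Rz Zt) lam8 lam12 lam13) Mstar ops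
    ζ9 lamW w hC hγ hL hup (fun P => (socket05_pinX3_iff F N (theta13LiveOfFamily₂ F N ε₀ ε₂₉ ζ Rz Zt) lam8 lam12 lam13 P).2 (h05 P)) h06 h07 h08 (fun P => (socket09_pinX3_iff F N
    (theta13LiveOfFamily₂ F N ε₀ ε₂₉ ζ Rz Zt) lam8 lam12 lam13 P).2 (h09 P)) h09T (fun P _ _ _ _ => (socket10_pinX3_iff F N (theta13LiveOfFamily₂ F N ε₀ ε₂₉ ζ Rz Zt) lam8 lam12 lam13 P).2 (h10
    P)) h11 h12 hUV hlo hhi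

/-! ## §3. The REGISTERED rung-1 body `NodesAtSomeRecord13P` at the X-pinned parameter (θ-generic; the `stub_nodes13P` closer shape modulo the displayed sockets) -/
/-- **★ THE BODY OF THE REGISTERED RUNG `K1Skeleton13Sep.NodesAtSomeRecord13P` (rev 18, v2 «N08 PINNED BY NAME»; general `N`) WITNESSED BY THE K0⁗ TUPLE ITSELF `(θ, hP)` AND A
WORLD BOUND TO THE FOUR-PIN VIEW OF ITS X-PINNED PARAMETER `θ.pinX3 lam8 lam12 lam13`, N05 ∕ N09 ∕ N10 ← THEIR LEAVES OF RECORD, N08 ← the displayed `PrintedUV3V N θ.L`,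
EVERY OTHER SOCKET θ-KEYED** — §1 `nodes₁₃Sep_pinX3_of_leaves` packed with the guard `hU` and admissibility: the closer SHAPE of `stub_nodes13P` (`Inhabited13 F` hands an
ARBITRARY admissible guarded `θ` with `Provisos₁₃Sep`; this theorem serves that very `θ`, re-binding only the world's X-readings), modulo the thirteen displayed sockets (of which
(R₁₃) `hR` is a theorem only on live re-pins — dag-n24-c's «WHICH CHILD BLOCKS» list).  The X-rebound rung-1 body is not among modules 43⁗ ∕ 44⁗'s nine theorems (they carry the
K1⁗ consequent and the rung-2 body); dag-n24-c's 40⁗ `N24_nodesAtSomeRecord₁₃Sep_of_fourPin_pointed` is its un-rebound form (X-sockets at `θ.res.X P`, undischargeable at K0a's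
witnesses — LOCATED-N24-XSOCKET).  COMPOSITE; NOT the stub; nothing discharged. [cite: Balaban1989LargeFieldII, Thm 1 p.355, (0.1) pp.355–356, p.391; Balaban1988Convergent, (2.18) p.257, (2.28) p.259, (3.16)–(3.22) pp.268–269; Balaban1985UV3, Thm 1 p.257 + Thm 2 p.272; Balaban1987RG1, Thm 3 p.264, (1.22) p.264, Lemma 4 p.280; Balaban1985RegularSpaces, Thm 2 p.83; Balaban1985BackgroundPropagators, Thm 3.1 p.397; Balaban1985Variational, Thm 1 p.279; Balaban1989LargeFieldI, Prop. 1 p.194; Balaban1988RG2Cluster, Lemmas 1–3 pp.9–20 (bookkeeping)] -/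
theorem nodesAtSomeRecord₁₃SepP_pinX3_of_leaves (θ : Stage13Params F N) (hP : θ.Provisos₁₃Sep F N) (hθ : θ.Admissible F N) (hU : θ.ZtUnity F N ∧ θ.SlotsNondegenerate₁₃ F N)
    (lam8 : ResidB8 θ.toStage3Params) (lam12 : ResidB12 F N θ.τ9.M) (lam13 : B12.RunParams → ResidB13 θ.toStage3Params) (Mstar : ℕ) (ops : OpsY N θ.toStage3Params Mstar) (ζ : ResidZ F N)
    (lamW : ResidW F N) (w : WorldP) (hC : w.C = (datumOfRecord₁₃Sep F N θ hP).C) (hγ : 0 < w.γ ∧ w.γ ≤ θ.γ) (hL : w.L = (θ.L : ℝ))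
    (hup : ∀ P, w.up P = upOfRecord₅C F N ((θ.pinX3 F N lam8 lam12 lam13).view₁₃B10YZW F N Mstar ops ζ lamW) P)
    (h05 : ∀ P : B12.RunParams, B8LeafR θ.D (θ.L : ℝ) lam8.C₂ lam8.B₁' lam8.inp.B₀' lam8.B₁ lam8.B₂ lam8.c₁ lam8.inp lam8.B₀β
      (B8Lemma1NonAbelian.blockPairNA θ.D θ.L θ.𝔸) (fun j : IdxB8SubB θ.toStage3Params => famB8OfRecordSubB θ.toStage3Params lam8.β lam8.len j)
      lam8.lan lam8.cub (fun j => lam8.toAxial j.1))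
    (h06 : B9LeafX (Y9OfRecord N θ.toStage3Params Mstar ops)) (h07 : B11Leaf (Z11OfRecord F N ζ)) (h08 : PrintedUV3V N θ.L)
    (h09 : ∀ P : B12.RunParams, B12Sec2to5.Lemma4Printed (F12OfRecord₁₂ F N θ.toStage12Params lam12 P) (lam12 P).consts)
    (h09T : ∀ P : B12.RunParams, (leavesP w P).smallCouplings → (leavesP w P).smallFieldInductive) (h10 : ∀ P : B12.RunParams, B13LeafOfRecord θ.toStage3Params (lam13 P))
    (h11 : ∀ P : B12.RunParams, (leavesP w P).b7 → (leavesP w P).b8 → (leavesP w P).b9 → (leavesP w P).b10 → (leavesP w P).b11 →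
      (leavesP w P).smallCouplings → (leavesP w P).smallFieldInductive → (leavesP w P).flowControl →
        ∀ k, k < P.K → SLaw₁₃ F N θ P k → TLaw₁₃ F N θ P k)
    (h12 : ∀ P : B12.RunParams, B15Leaf (WOfRecord₁₃ F N θ lamW P)) (hR : ∀ (P : B12.RunParams) (k : ℕ), k < P.K → TLaw₁₃ F N θ P k → SLaw₁₃ F N θ P (k + 1))
    (hUV : ∀ P : B12.RunParams, (genFlow (betaOfRecord₁₃ F N θ) P.g0).InInterval w.γ P.K → ∀ k, k ≤ P.K → SLaw₁₃ F N θ P k →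
      ∀ U : GaugeField (F.P P.K) k (SU N),
        chiβOfRecord₁₃ F N θ P.K (gOfRecord₁₃ F N θ P) k U *
              Real.exp (-(1 / (gOfRecord₁₃ F N θ P k) ^ 2 * wilsonBGOfRecord F N θ.εbg P k U)
                - w.em (gOfRecord₁₃ F N θ P k) * (Fintype.card (Site (F.P P.K) k) : ℝ)) ≤ densOfRecord₁₃ F N θ P k U ∧
        densOfRecord₁₃ F N θ P k U ≤ Real.exp (w.ep (gOfRecord₁₃ F N θ P k) * (Fintype.card (Site (F.P P.K) k) : ℝ))) :
    ∃ (θ' : Stage13Params F N) (h' : θ'.Provisos₁₃Sep F N) (w' : WorldP), (θ'.ZtUnity F N ∧ θ'.SlotsNondegenerate₁₃ F N) ∧ θ'.Admissible F N ∧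
      IsRecordOfRecord₁₃CSep F N (datumOfRecord₁₃Sep F N θ' h') w' ∧ (∀ P : B12.RunParams, Nodes (leavesP w' P)) ∧ PrintedUV3V N θ'.L := by
  obtain ⟨hrec, hn⟩ := nodes₁₃Sep_pinX3_of_leaves θ hP hθ lam8 lam12 lam13 Mstar ops ζ lamW w hC hγ hL hup h05 h06 h07 h08 h09 h09T h10 h11 h12 hR hUV
  exact ⟨θ, hP, w, hU, hθ, hrec, hn, h08⟩

/-- **★★ THE SAME WITH EVERY RESIDUAL GROUP PINNED BY NAME IN THE CONCLUSION** — the rung-1 body STRENGTHENED by the world-binding conjunct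
`∀ P, w'.up P = upOfRecord₅C F N ((θ'.pinX3 F N lam8' lam12' lam13').view₁₃B10YZW F N Mstar' ops' ζ' lamW') P` with the seven residual data ∃-BOUND (X: [B8″]∕[B12]∕[B13] via
`Stage13Params.pinX3`; [B9] `(Mstar', ops')`, [B11] `ζ'`, [B15] `lamW'` via `view₁₃B10YZW`, whose [B10] slot stays θ's OWN run family — N08 is measured by the displayed
`PrintedUV3V N θ'.L`, v2's pin): the [B8″]∕[B12]∕[B13]∕[B9]∕[B11]∕[B15] leaves of `w'` ARE the pinned carriers' leaves, so those conjuncts of `Nodes` cannot close at an `Empty` ∕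
`Classical.choice` carrier family — the all-groups form of the cure dag-ref-G AUDIT-A2b asks for (N05 ∕ N06 ∕ N07) and plan g67 adopted «in principle» for rung 1 v3
(«pins the three residual groups BY NAME … sockets `Stage13Params.pinX3` ∕ `.pinY` ∕ `.pinZ`», bus l.17101 (4)); OFFERED as a candidate v3 text at `N := 2` (the plan words the
rung; this seat only shows the shape is closable from the displayed sockets by `exact`).  Same proof as above with `hup` kept.  COMPOSITE; NOT the stub; nothing discharged. [cite: Balaban1989LargeFieldII, Thm 1 p.355, (0.1) pp.355–356, p.391; Balaban1988Convergent, (2.18) p.257, (2.28) p.259, (3.16)–(3.22) pp.268–269; Balaban1985UV3, Thm 1 p.257 + Thm 2 p.272; Balaban1987RG1, Thm 3 p.264, (1.22) p.264, Lemma 4 p.280; Balaban1985RegularSpaces, Thm 2 p.83; Balaban1985BackgroundPropagators, Thm 3.1 p.397; Balaban1985Variational, Thm 1 p.279; Balaban1989LargeFieldI, Prop. 1 p.194; Balaban1988RG2Cluster, Lemmas 1–3 pp.9–20 (bookkeeping)] -/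
theorem nodesAtSomeRecord₁₃SepP_allPinned_of_leaves (θ : Stage13Params F N) (hP : θ.Provisos₁₃Sep F N) (hθ : θ.Admissible F N) (hU : θ.ZtUnity F N ∧ θ.SlotsNondegenerate₁₃ F N)
    (lam8 : ResidB8 θ.toStage3Params) (lam12 : ResidB12 F N θ.τ9.M) (lam13 : B12.RunParams → ResidB13 θ.toStage3Params) (Mstar : ℕ) (ops : OpsY N θ.toStage3Params Mstar) (ζ : ResidZ F N)
    (lamW : ResidW F N) (w : WorldP) (hC : w.C = (datumOfRecord₁₃Sep F N θ hP).C) (hγ : 0 < w.γ ∧ w.γ ≤ θ.γ) (hL : w.L = (θ.L : ℝ))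
    (hup : ∀ P, w.up P = upOfRecord₅C F N ((θ.pinX3 F N lam8 lam12 lam13).view₁₃B10YZW F N Mstar ops ζ lamW) P)
    (h05 : ∀ P : B12.RunParams, B8LeafR θ.D (θ.L : ℝ) lam8.C₂ lam8.B₁' lam8.inp.B₀' lam8.B₁ lam8.B₂ lam8.c₁ lam8.inp lam8.B₀β
      (B8Lemma1NonAbelian.blockPairNA θ.D θ.L θ.𝔸) (fun j : IdxB8SubB θ.toStage3Params => famB8OfRecordSubB θ.toStage3Params lam8.β lam8.len j)
      lam8.lan lam8.cub (fun j => lam8.toAxial j.1))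
    (h06 : B9LeafX (Y9OfRecord N θ.toStage3Params Mstar ops)) (h07 : B11Leaf (Z11OfRecord F N ζ)) (h08 : PrintedUV3V N θ.L)
    (h09 : ∀ P : B12.RunParams, B12Sec2to5.Lemma4Printed (F12OfRecord₁₂ F N θ.toStage12Params lam12 P) (lam12 P).consts)
    (h09T : ∀ P : B12.RunParams, (leavesP w P).smallCouplings → (leavesP w P).smallFieldInductive) (h10 : ∀ P : B12.RunParams, B13LeafOfRecord θ.toStage3Params (lam13 P))
    (h11 : ∀ P : B12.RunParams, (leavesP w P).b7 → (leavesP w P).b8 → (leavesP w P).b9 → (leavesP w P).b10 → (leavesP w P).b11 →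
      (leavesP w P).smallCouplings → (leavesP w P).smallFieldInductive → (leavesP w P).flowControl →
        ∀ k, k < P.K → SLaw₁₃ F N θ P k → TLaw₁₃ F N θ P k)
    (h12 : ∀ P : B12.RunParams, B15Leaf (WOfRecord₁₃ F N θ lamW P)) (hR : ∀ (P : B12.RunParams) (k : ℕ), k < P.K → TLaw₁₃ F N θ P k → SLaw₁₃ F N θ P (k + 1))
    (hUV : ∀ P : B12.RunParams, (genFlow (betaOfRecord₁₃ F N θ) P.g0).InInterval w.γ P.K → ∀ k, k ≤ P.K → SLaw₁₃ F N θ P k →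
      ∀ U : GaugeField (F.P P.K) k (SU N),
        chiβOfRecord₁₃ F N θ P.K (gOfRecord₁₃ F N θ P) k U *
              Real.exp (-(1 / (gOfRecord₁₃ F N θ P k) ^ 2 * wilsonBGOfRecord F N θ.εbg P k U)
                - w.em (gOfRecord₁₃ F N θ P k) * (Fintype.card (Site (F.P P.K) k) : ℝ)) ≤ densOfRecord₁₃ F N θ P k U ∧
        densOfRecord₁₃ F N θ P k U ≤ Real.exp (w.ep (gOfRecord₁₃ F N θ P k) * (Fintype.card (Site (F.P P.K) k) : ℝ))) :
    ∃ (θ' : Stage13Params F N) (h' : θ'.Provisos₁₃Sep F N) (lam8' : ResidB8 θ'.toStage3Params) (lam12' : ResidB12 F N θ'.τ9.M)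
      (lam13' : B12.RunParams → ResidB13 θ'.toStage3Params) (Mstar' : ℕ) (ops' : OpsY N θ'.toStage3Params Mstar') (ζ' : ResidZ F N) (lamW' : ResidW F N) (w' : WorldP),
      (θ'.ZtUnity F N ∧ θ'.SlotsNondegenerate₁₃ F N) ∧ θ'.Admissible F N ∧ IsRecordOfRecord₁₃CSep F N (datumOfRecord₁₃Sep F N θ' h') w' ∧
      (∀ P, w'.up P = upOfRecord₅C F N ((θ'.pinX3 F N lam8' lam12' lam13').view₁₃B10YZW F N Mstar' ops' ζ' lamW') P) ∧
      (∀ P : B12.RunParams, Nodes (leavesP w' P)) ∧ PrintedUV3V N θ'.L := by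
  obtain ⟨hrec, hn⟩ := nodes₁₃Sep_pinX3_of_leaves θ hP hθ lam8 lam12 lam13 Mstar ops ζ lamW w hC hγ hL hup h05 h06 h07 h08 h09 h09T h10 h11 h12 hR hUV
  exact ⟨θ, hP, lam8, lam12, lam13, Mstar, ops, ζ, lamW, w, hU, hθ, hrec, hup, hn, h08⟩

end Summit.QuantumFields.YangMills.BalabanUVNodes.N10XPinnedClosers13Sep
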